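import Summits.CriticalPhenomena.PercolationContinuityZ3.Theorems.PercNearOneGluingNoHeavyQuantLSCoreLLGBreakpoints
import Summits.CriticalPhenomena.PercolationContinuityZ3.Theorems.PercNearOneGluingNoHeavyQuantLSCoreLLGBreakpointsB1
import Summits.CriticalPhenomena.PercolationContinuityZ3.Theorems.PercNearOneGluingNoHeavyQuantLSCoreLLGBreakpointsA
import Summits.CriticalPhenomena.PercolationContinuityZ3.Theorems.PercNearOneGluingNoHeavyQuantLSCoreLLGBreakpointsC
import Summits.CriticalPhenomena.PercolationContinuityZ3.Theorems.PercNearOneGluingNoHeavyQuantLSCoreMMGEff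
import Summits.CriticalPhenomena.PercolationContinuityZ3.Theorems.PercNearOneGluingNoHeavyQuantLSCoreFlowC
import Summits.CriticalPhenomena.PercolationContinuityZ3.Theorems.PercNearOneGluingNoHeavyQuantTwoLowGreedy
import HarnessLib
/-!
# QUANT lane R8, T-DEC, binder (II) `ConvClosedTResidue`: LS-CORE, pattern LLG — DEC of the six-cell light-slice law when both row-`m` cells are low (`2(m+l′) < T ≤ 2(p+h)`), span ratio `ω ≤ 1`
builds on p205010 (kernel theorem, internal audit signed; external expert review pending)
Support file (`--supports stmt-CriticalPhenomena-4575`), QUANT lane seat prim-quant-census-1 (gen 22), rung R8 of `run/shared/lean/prim/quant/LADDER.md`;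
memo `run/shared/lean/prim/quant/prim-quant-census-1/LSCORE-G22.md` §9–§16 (method: two-low greedy at the breakpoints `kG`, `kB`, `G0`, leaf inequalities by
LP certificates and nested Bernstein forms).  Companion of `…QuantLSCoreMMG` (`lsCore_MMG_decAtT`).  Theorems only, standard axioms, no sorries.
-/
noncomputable section
namespace Summit.CriticalPhenomena.PercolationContinuityZ3.Theorems
namespace Quant
open Finset
namespace LawDec
namespace LSCoreLLG
set_option maxHeartbeats 8000000 in
/-- **`kB` for pattern LLG (low 2 stops at the head cell; both pre-routings fit)**: `P₁ ≤ (a₂(p+h)″ − P₂)·κ + pool`. [this work] -/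
theorem kB_LLG (x r t d w e2P e3 κP cP1 pool1 cPres poolres : ℝ) (hx0 : 0 < x) (hx1 : x < 1) (hr0 : 0 ≤ r) (hrx : r < x) (ht : 0 < t) (hw0 : 0 < w) (hw1 : w < 1)
    (hd0 : 0 ≤ d) (hdx : d < x * w) (hre : 0 < r - x + t * (2 - x)) (hre1 : 0 < 1 - t - r)
    (hM2 : 2 * w < r + d)
    (h2P_N : 1 ≤ (r + d) → e2P = 0)
    (h2P_H : x ≤ (r + d) → (r + d) < 1 → e2P = (1 / (r + d) - 1))
    (h2P_L : (r + d) < x → e2P = (1 / ((1 - x) * (r + d) + x ^ (2:ℕ)) - 1))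
    (h3_H : x * (1 + t - w) ≤ (r + d + 2 * t - 2 * w) → e3 = (((1 + t - w) - (r + d + 2 * t - 2 * w)) / (r + d + 2 * t - 2 * w)))
    (h3_L : (r + d + 2 * t - 2 * w) < x * (1 + t - w) → e3 = (((1 + t - w) - ((1 - x) * (r + d + 2 * t - 2 * w) + x ^ (2:ℕ) * (1 + t - w))) / ((1 - x) * (r + d + 2 * t - 2 * w) + x ^ (2:ℕ) * (1 + t - w))))
    (hκ_N : 1 + t ≤ (r + d + 2 * t) → κP = 0) (hκ_H : (r + d + 2 * t) < 1 + t → x ≤ (r + d) → (r + d) < 1 → κP = (((1 + t) - (r + d + 2 * t)) * (r + d) / ((r + d + 2 * t) * (1 - (r + d))))) (hκ_L : (r + d + 2 * t) < 1 + t → (r + d) < x → κP = (((1 + t) - (r + d + 2 * t)) * ((1 - x) * (r + d) + x ^ (2:ℕ)) / ((r + d + 2 * t) * (1 - ((1 - x) * (r + d) + x ^ (2:ℕ))))))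
    (hc4_f : ((x ^ (2:ℕ) + (1 - x) * d / w) * (1 - x) * ((1 + x - r) * (r - x + t * (2 - x)) / (t * (2 - x ^ (2:ℕ) - (1 - x) * r) - x * (x - r)))) ≤ ((1 - (x ^ (2:ℕ) + (1 - x) * d / w)) * x) * (((1 - w) - ((1 - x) * (r + d - 2 * w) + x ^ (2:ℕ) * (1 - w))) / ((1 - x) * (r + d - 2 * w) + x ^ (2:ℕ) * (1 - w))) → cP1 = ((1 - (x ^ (2:ℕ) + (1 - x) * d / w)) * x) - ((x ^ (2:ℕ) + (1 - x) * d / w) * (1 - x) * ((1 + x - r) * (r - x + t * (2 - x)) / (t * (2 - x ^ (2:ℕ) - (1 - x) * r) - x * (x - r)))) / (((1 - w) - ((1 - x) * (r + d - 2 * w) + x ^ (2:ℕ) * (1 - w))) / ((1 - x) * (r + d - 2 * w) + x ^ (2:ℕ) * (1 - w))) ∧ pool1 = ((x ^ (2:ℕ) + (1 - x) * d / w) * (1 - x)))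
    (hc4_s : ((1 - (x ^ (2:ℕ) + (1 - x) * d / w)) * x) * (((1 - w) - ((1 - x) * (r + d - 2 * w) + x ^ (2:ℕ) * (1 - w))) / ((1 - x) * (r + d - 2 * w) + x ^ (2:ℕ) * (1 - w))) < ((x ^ (2:ℕ) + (1 - x) * d / w) * (1 - x) * ((1 + x - r) * (r - x + t * (2 - x)) / (t * (2 - x ^ (2:ℕ) - (1 - x) * r) - x * (x - r)))) → cP1 = 0 ∧ pool1 = (((x ^ (2:ℕ) + (1 - x) * d / w) * (1 - x)) - ((x ^ (2:ℕ) + (1 - x) * d / w) * (1 - x) * ((1 + x - r) * (r - x + t * (2 - x)) / (t * (2 - x ^ (2:ℕ) - (1 - x) * r) - x * (x - r)))) + ((1 - (x ^ (2:ℕ) + (1 - x) * d / w)) * x) * (((1 - w) - ((1 - x) * (r + d - 2 * w) + x ^ (2:ℕ) * (1 - w))) / ((1 - x) * (r + d - 2 * w) + x ^ (2:ℕ) * (1 - w)))))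
    (hc3_f : ((x ^ (2:ℕ) + (1 - x) * d / w) * (1 - x) * ((x - r) * (1 - t - r) / (t * (2 - x ^ (2:ℕ) - (1 - x) * r) - x * (x - r)))) ≤ cP1 * e3 → cPres = cP1 - ((x ^ (2:ℕ) + (1 - x) * d / w) * (1 - x) * ((x - r) * (1 - t - r) / (t * (2 - x ^ (2:ℕ) - (1 - x) * r) - x * (x - r)))) / e3 ∧ poolres = pool1)
    (hc3_s : cP1 * e3 < ((x ^ (2:ℕ) + (1 - x) * d / w) * (1 - x) * ((x - r) * (1 - t - r) / (t * (2 - x ^ (2:ℕ) - (1 - x) * r) - x * (x - r)))) → cPres = 0 ∧ poolres = (pool1 - ((x ^ (2:ℕ) + (1 - x) * d / w) * (1 - x) * ((x - r) * (1 - t - r) / (t * (2 - x ^ (2:ℕ) - (1 - x) * r) - x * (x - r)))) + cP1 * e3))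
    (hav : (r + d) < 1) (hf4 : ((x ^ (2:ℕ) + (1 - x) * d / w) * (1 - x) * ((1 + x - r) * (r - x + t * (2 - x)) / (t * (2 - x ^ (2:ℕ) - (1 - x) * r) - x * (x - r)))) ≤ ((1 - (x ^ (2:ℕ) + (1 - x) * d / w)) * x) * (((1 - w) - ((1 - x) * (r + d - 2 * w) + x ^ (2:ℕ) * (1 - w))) / ((1 - x) * (r + d - 2 * w) + x ^ (2:ℕ) * (1 - w)))) (hf3 : ((x ^ (2:ℕ) + (1 - x) * d / w) * (1 - x) * ((x - r) * (1 - t - r) / (t * (2 - x ^ (2:ℕ) - (1 - x) * r) - x * (x - r)))) ≤ cP1 * e3) (hpre : ((1 - (x ^ (2:ℕ) + (1 - x) * d / w)) * (1 - x) * ((1 + x - r) * (r - x + t * (2 - x)) / (t * (2 - x ^ (2:ℕ) - (1 - x) * r) - x * (x - r)))) ≤ cPres * e2P) :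
    ((1 - (x ^ (2:ℕ) + (1 - x) * d / w)) * (1 - x) * ((x - r) * (1 - t - r) / (t * (2 - x ^ (2:ℕ) - (1 - x) * r) - x * (x - r)))) ≤ (cPres * e2P - ((1 - (x ^ (2:ℕ) + (1 - x) * d / w)) * (1 - x) * ((1 + x - r) * (r - x + t * (2 - x)) / (t * (2 - x ^ (2:ℕ) - (1 - x) * r) - x * (x - r))))) * κP + poolres := by
  rcases le_or_gt (x * (1 + t - w)) ((r + d + 2 * t - 2 * w)) with hk3 | hk3
  · exact kB_LLG_H x r t d w e2P e3 κP cP1 pool1 cPres poolres hx0 hx1 hr0 hrx ht hw0 hw1 hd0 hdx hre hre1 hM2 h2P_N h2P_H h2P_L h3_H h3_L hκ_N hκ_H hκ_L hc4_f hc4_s hc3_f hc3_s hav hf4 hf3 hpre hk3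
  · exact kB_LLG_L x r t d w e2P e3 κP cP1 pool1 cPres poolres hx0 hx1 hr0 hrx ht hw0 hw1 hd0 hdx hre hre1 hM2 h2P_N h2P_H h2P_L h3_H h3_L hκ_N hκ_H hκ_L hc4_f hc4_s hc3_f hc3_s hav hf4 hf3 hpre hk3
end LSCoreLLG
open LSCoreMMG LSCoreLLG
set_option maxHeartbeats 40000000 in
/-- **LS-CORE, PATTERN LLG (Type I ⊗ Type I, span ratio ≤ 1).**  As `lsCore_MMG_decAtT` but in the pattern `2(m+l′) < T`
(both light cells of row `m` are lows, the head cell `p+h` is the only mid): the six-cell law `(1−γ)·shift_p ν_B + γ·shift_m ν_B` is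
`DECAtT x T j M`. [this work] -/
theorem lsCore_LLG_decAtT (x T ρc ρl ρe lam : ℝ) (p m l l' h j M : ℕ)
    (hx0 : 0 < x) (hx1 : x < 1) (hpm : p < m) (hll : l < l') (hlh : l' < h)
    (_hω : m + l' ≤ p + h) (hPj : p + h ≤ j) (hGj : j < m + h) (hGM : m + h ≤ M)
    (_hρc0 : 0 < ρc) (hρcx : ρc < x) (hρl0 : 0 ≤ ρl) (hρlx : ρl < x) (hρex : x < ρe) (hρe1 : ρe < 1)
    (hTB : ρe * ((h : ℝ) - l) = ρl * ((h : ℝ) - l') + 2 * ((l' : ℝ) - l))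
    (hT : T = 2 * ((p : ℝ) + l') + ρl * ((h : ℝ) - l') + ρc * ((m : ℝ) - p))
    (hlam0 : 0 ≤ lam) (_hlam1 : lam ≤ 1)
    (hcredit : lam * (ρe - (x ^ (2:ℕ) + (1 - x) * ρl)) = (x - ρl) * (1 - ρe))
    (hA2 : T ≤ 2 * ((p : ℝ) + h)) (hM2 : 2 * ((m : ℝ) + l') < T) :
    DECAtT x T j M (fun q => (1 - (x ^ (2:ℕ) + (1 - x) * ρc)) * (1 - x) * lam * (if q = p + l then (1:ℝ) else 0)
      + (1 - (x ^ (2:ℕ) + (1 - x) * ρc)) * (1 - x) * (1 - lam) * (if q = p + l' then (1:ℝ) else 0)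
      + (1 - (x ^ (2:ℕ) + (1 - x) * ρc)) * x * (if q = p + h then (1:ℝ) else 0)
      + (x ^ (2:ℕ) + (1 - x) * ρc) * (1 - x) * lam * (if q = m + l then (1:ℝ) else 0)
      + (x ^ (2:ℕ) + (1 - x) * ρc) * (1 - x) * (1 - lam) * (if q = m + l' then (1:ℝ) else 0)
      + (x ^ (2:ℕ) + (1 - x) * ρc) * x * (if q = m + h then (1:ℝ) else 0)) := by
  classical
  have he : (0 : ℝ) < (h : ℝ) - l' := by
    linarith [show (l' : ℝ) < h from by exact_mod_cast hlh]
  obtain ⟨e, he_def⟩ : ∃ e : ℝ, e = (h : ℝ) - l' := ⟨_, rfl⟩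
  rw [← he_def] at he
  set r : ℝ := ρl with hr_def
  obtain ⟨t, ht_def⟩ : ∃ t : ℝ, t = ((l' : ℝ) - l) / e := ⟨_, rfl⟩
  obtain ⟨w, hw_def⟩ : ∃ w : ℝ, w = ((m : ℝ) - p) / e := ⟨_, rfl⟩
  obtain ⟨d, hd_def⟩ : ∃ d : ℝ, d = ρc * w := ⟨_, rfl⟩
  have hte : t * e = (l' : ℝ) - l := by rw [ht_def]; exact div_mul_cancel₀ _ he.ne'
  have hwe : w * e = (m : ℝ) - p := by rw [hw_def]; exact div_mul_cancel₀ _ he.ne'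
  have ht0 : 0 < t := by
    rw [ht_def]; apply div_pos _ he
    linarith [show (l : ℝ) < l' from by exact_mod_cast hll]
  have hw0 : 0 < w := by
    rw [hw_def]; apply div_pos _ he
    linarith [show (p : ℝ) < m from by exact_mod_cast hpm]
  have hw1 : w < 1 := by rw [hw_def, div_lt_one he]; have : 2 * ((m : ℝ) + l') < 2 * ((p : ℝ) + h) := lt_of_lt_of_le hM2 hA2; linarith
  have hd0 : 0 ≤ d := by rw [hd_def]; positivity
  have hdx : d < x * w := by rw [hd_def]; exact mul_lt_mul_of_pos_right hρcx hw0
  have hρet : ρe * (1 + t) = r + 2 * t := by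
    have h1 : ρe * ((h : ℝ) - l) = r * e + 2 * (t * e) := by rw [hTB, hte, he_def]
    have h2 : (h : ℝ) - l = e * (1 + t) := by
      have : (h : ℝ) - l = e + ((l' : ℝ) - l) := by rw [he_def]; ring
      rw [this, ← hte]; ring
    rw [h2] at h1
    have h3 : e * (ρe * (1 + t)) = e * (r + 2 * t) := by linear_combination h1
    exact mul_left_cancel₀ he.ne' h3
  have ht1 : (0 : ℝ) < 1 + t := by linarith
  have hre : 0 < r - x + t * (2 - x) := by have := mul_lt_mul_of_pos_right hρex ht1; linarith
  have hre1 : 0 < 1 - t - r := by have := mul_lt_mul_of_pos_right hρe1 ht1; linarith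
  have hTA : T - 2 * ((p : ℝ) + l') = e * (r + d) := by
    rw [hT, hd_def, hr_def]; rw [show ρc * ((m : ℝ) - p) = ρc * (w * e) by rw [hwe], he_def]; ring
  have hTB' : T - 2 * ((p : ℝ) + l) = e * (r + d + 2 * t) := by
    have : T - 2 * ((p : ℝ) + l) = (T - 2 * ((p : ℝ) + l')) + 2 * ((l' : ℝ) - l) := by ring
    rw [this, hTA, ← hte]; ring
  have hT3 : T - 2 * ((m : ℝ) + l) = e * (r + d + 2 * t - 2 * w) := by
    have : T - 2 * ((m : ℝ) + l) = (T - 2 * ((p : ℝ) + l)) - 2 * ((m : ℝ) - p) := by ring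
    rw [this, hTB', ← hwe]; ring
  have hT4 : T - 2 * ((m : ℝ) + l') = e * (r + d - 2 * w) := by
    have : T - 2 * ((m : ℝ) + l') = (T - 2 * ((p : ℝ) + l')) - 2 * ((m : ℝ) - p) := by ring
    rw [this, hTA, ← hwe]; ring
  have hM2' : 2 * w < r + d := by
    have h1 : 0 < e * (r + d - 2 * w) := by rw [← hT4]; linarith
    have h2 : e * 0 < e * (r + d - 2 * w) := by rwa [mul_zero]
    have h3 := lt_of_mul_lt_mul_left h2 he.le
    linarith
  have hM1' : 2 * w < r + d + 2 * t := by linarith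
  have hA2' : r + d ≤ 2 := by
    have h1 : e * (r + d) ≤ e * 2 := by
      have h3 : T - 2 * ((p : ℝ) + l') ≤ 2 * ((p : ℝ) + h) - 2 * ((p : ℝ) + l') := by linarith
      have h4 : 2 * ((p : ℝ) + h) - 2 * ((p : ℝ) + l') = e * 2 := by rw [he_def]; ring
      rw [hTA, h4] at h3; exact h3
    exact le_of_mul_le_mul_left h1 he
  have hApos : 0 < r + d := by
    have : 0 < d := by rw [hd_def]; positivity
    linarith
  have hB3pos : 0 < r + d + 2 * t - 2 * w := by linarith
  have hA4pos : 0 < r + d - 2 * w := by linarith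
  have hb3c : r + d + 2 * t - 2 * w < 1 + t - w := by nlinarith
  have hb4 : r + d - 2 * w < x * (1 - w) := by nlinarith
  have hb4c : r + d - 2 * w < 1 - w := by nlinarith
  have hD : 0 < t * (2 - x ^ (2:ℕ) - (1 - x) * r) - x * (x - r) := LSCoreMMG.D_pos x r t hx0 hx1 hρl0 hρlx hre
  have hlamD : lam * (t * (2 - x ^ (2:ℕ) - (1 - x) * r) - x * (x - r)) = (x - r) * (1 - t - r) := by
    linear_combination (1 + t) * hcredit - (lam + (x - r)) * hρet
  have hlam_eq : (x - r) * (1 - t - r) / (t * (2 - x ^ (2:ℕ) - (1 - x) * r) - x * (x - r)) = lam := by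
    rw [div_eq_iff hD.ne', hlamD]
  have hlaml_eq : (1 + x - r) * (r - x + t * (2 - x)) / (t * (2 - x ^ (2:ℕ) - (1 - x) * r) - x * (x - r)) = 1 - lam := by rw [div_eq_iff hD.ne']; linear_combination hlamD
  have hgd : x ^ (2:ℕ) + (1 - x) * d / w = x ^ (2:ℕ) + (1 - x) * ρc := by
    rw [hd_def, mul_div_assoc, mul_div_cancel_right₀ _ hw0.ne']
  have hγ0 : 0 < (x ^ (2:ℕ) + (1 - x) * ρc) := by positivity
  have hγ1 : (x ^ (2:ℕ) + (1 - x) * ρc) < 1 := by have := mul_lt_mul_of_pos_left hρcx (sub_pos.2 hx1); nlinarith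
  have hγ1' : 0 ≤ 1 - (x ^ (2:ℕ) + (1 - x) * ρc) := by linarith
  have hc1 : 0 ≤ (1 - (x ^ (2:ℕ) + (1 - x) * ρc)) * (1 - x) * lam := mul_nonneg (mul_nonneg hγ1' (by linarith)) hlam0
  have hc2 : 0 ≤ (1 - (x ^ (2:ℕ) + (1 - x) * ρc)) * (1 - x) * (1 - lam) := mul_nonneg (mul_nonneg hγ1' (by linarith)) (by linarith)
  have hcP : 0 ≤ (1 - (x ^ (2:ℕ) + (1 - x) * ρc)) * x := mul_nonneg hγ1' hx0.le
  have hd1 : 0 ≤ (x ^ (2:ℕ) + (1 - x) * ρc) * (1 - x) * lam := mul_nonneg (mul_nonneg hγ0.le (by linarith)) hlam0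
  have hd2 : 0 ≤ (x ^ (2:ℕ) + (1 - x) * ρc) * (1 - x) * (1 - lam) := mul_nonneg (mul_nonneg hγ0.le (by linarith)) (by linarith)
  have hdG : 0 ≤ (x ^ (2:ℕ) + (1 - x) * ρc) * x := mul_nonneg hγ0.le hx0.le
  have hu : 0 < x / (1 - x) := div_pos hx0 (by linarith)
  obtain ⟨e2P, e22, e21, e1P, e12, e11, κC, κB, κA, h2P_N, h2P_H, h2P_L, h22_N, h22_H, h22_L, h21_N, h21_H, h21_L, h1P_N, h1P_H, h12_N, h12_H, h11_N, h11_H, he2P0, he220, he210, he1P0, he120, he110, hκC_N, hκC_H, hκC_L, hκB_N, hκB_H, hκB_L, hκA_N, hκA_H, hκA_L, hκC0, hκB0, hκA0, hκCe, hκBe, hκAe⟩ :=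
    eff_package x r t d w hx0 hx1 ht0 hw0 hApos
  obtain ⟨e3, h3_H, h3_L⟩ : ∃ e3 : ℝ, (x * (1 + t - w) ≤ (r + d + 2 * t - 2 * w) → e3 = (((1 + t - w) - (r + d + 2 * t - 2 * w)) / (r + d + 2 * t - 2 * w))) ∧
      ((r + d + 2 * t - 2 * w) < x * (1 + t - w) → e3 = (((1 + t - w) - ((1 - x) * (r + d + 2 * t - 2 * w) + x ^ (2:ℕ) * (1 + t - w))) / ((1 - x) * (r + d + 2 * t - 2 * w) + x ^ (2:ℕ) * (1 + t - w)))) := by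
    by_cases hh : x * (1 + t - w) ≤ (r + d + 2 * t - 2 * w)
    · exact ⟨(((1 + t - w) - (r + d + 2 * t - 2 * w)) / (r + d + 2 * t - 2 * w)), fun _ => rfl, fun h2 => absurd hh (not_le.2 h2)⟩
    · exact ⟨(((1 + t - w) - ((1 - x) * (r + d + 2 * t - 2 * w) + x ^ (2:ℕ) * (1 + t - w))) / ((1 - x) * (r + d + 2 * t - 2 * w) + x ^ (2:ℕ) * (1 + t - w))), fun h2 => absurd h2 hh, fun _ => rfl⟩
  have hBpos : 0 < r + d + 2 * t := by linarith
  have hxB : x * (1 + t) ≤ r + d + 2 * t := by have := mul_lt_mul_of_pos_right hρex ht1; linarith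
  have hΔC2 : T - 2 * ((p + l' : ℕ) : ℝ) = e * (r + d) := by push_cast; linarith [hTA]
  have hΔC1 : T - 2 * ((p + l : ℕ) : ℝ) = e * (r + d + 2 * t) := by push_cast; linarith [hTB']
  have hΔ3 : T - 2 * ((m + l : ℕ) : ℝ) = e * (r + d + 2 * t - 2 * w) := by push_cast; linarith [hT3]
  have hΔ4 : T - 2 * ((m + l' : ℕ) : ℝ) = e * (r + d - 2 * w) := by push_cast; linarith [hT4]
  have hδC2 : ((p + h : ℕ) : ℝ) - ((p + l' : ℕ) : ℝ) = e * 1 := by push_cast; linear_combination -he_def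
  have hδC1 : ((p + h : ℕ) : ℝ) - ((p + l : ℕ) : ℝ) = e * (1 + t) := by push_cast; linear_combination -he_def - hte
  have hδB2 : ((m + l' : ℕ) : ℝ) - ((p + l' : ℕ) : ℝ) = e * w := by push_cast; linear_combination -hwe
  have hδB1 : ((m + l' : ℕ) : ℝ) - ((p + l : ℕ) : ℝ) = e * (w + t) := by push_cast; linear_combination -hwe - hte
  have hδ3 : ((p + h : ℕ) : ℝ) - ((m + l : ℕ) : ℝ) = e * (1 + t - w) := by push_cast; linear_combination -he_def - hte + hwe
  have hδ4 : ((p + h : ℕ) : ℝ) - ((m + l' : ℕ) : ℝ) = e * (1 - w) := by push_cast; linear_combination -he_def + hwe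
  have havC2 : (T < ((p + l' : ℕ) : ℝ) + ((p + h : ℕ) : ℝ)) ↔ r + d < 1 := by
    constructor
    · intro hh
      have h1 : e * (r + d) < e * (1) := by linarith [hΔC2, hδC2]
      exact lt_of_mul_lt_mul_left h1 he.le
    · intro hh
      have h1 : e * (r + d) < e * (1) := mul_lt_mul_of_pos_left hh he
      linarith [hΔC2, hδC2]
  have havC1 : (T < ((p + l : ℕ) : ℝ) + ((p + h : ℕ) : ℝ)) ↔ r + d + 2 * t < 1 + t := by
    constructor
    · intro hh
      have h1 : e * (r + d + 2 * t) < e * (1 + t) := by linarith [hΔC1, hδC1]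
      exact lt_of_mul_lt_mul_left h1 he.le
    · intro hh
      have h1 : e * (r + d + 2 * t) < e * (1 + t) := mul_lt_mul_of_pos_left hh he
      linarith [hΔC1, hδC1]
  have hav3 : T < ((m + l : ℕ) : ℝ) + ((p + h : ℕ) : ℝ) := by have h1 : e * (r + d + 2 * t - 2 * w) < e * (1 + t - w) := mul_lt_mul_of_pos_left hb3c he; linarith [hΔ3, hδ3]
  have huC2 : r + d < 1 → 0 < usage x T j (p + l') (p + h) ∧ e2P * usage x T j (p + l') (p + h) = 1 := by
    intro hav
    rcases lt_or_ge (r + d) x with hL | hH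
    · rw [h2P_L hL]
      have := usage_light_scaled x T e (r + d) 1 j (p + l') (p + h) hx0 hx1 he hPj hΔC2 hδC2 hApos hav (by linarith)
      simpa only [mul_one] using this
    · rw [h2P_H hH hav]
      exact usage_heavy_scaled x T e (r + d) 1 j (p + l') (p + h) hx0 hx1 he hPj hΔC2 hδC2 hApos hav (by linarith)
  have huC1 : r + d + 2 * t < 1 + t → 0 < usage x T j (p + l) (p + h) ∧ e1P * usage x T j (p + l) (p + h) = 1 := by
    intro hav
    rw [h1P_H hav]
    exact usage_heavy_scaled x T e (r + d + 2 * t) (1 + t) j (p + l) (p + h) hx0 hx1 he hPj hΔC1 hδC1 hBpos hav hxB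
  have hG3pos : 0 < (1 - x) * (r + d + 2 * t - 2 * w) + x ^ (2:ℕ) * (1 + t - w) := add_pos_of_pos_of_nonneg (mul_pos (by linarith) hB3pos) (mul_nonneg (sq_nonneg x) (by linarith))
  have hu3 : 0 < usage x T j (m + l) (p + h) ∧ e3 * usage x T j (m + l) (p + h) = 1 := by
    rcases le_or_gt (x * (1 + t - w)) (r + d + 2 * t - 2 * w) with hH | hL
    · rw [h3_H hH]
      have := usage_heavy_scaled x T e (r + d + 2 * t - 2 * w) (1 + t - w) j (m + l) (p + h) hx0 hx1 he hPj hΔ3 hδ3 hB3pos hb3c hH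
      rwa [div_sub_one hB3pos.ne'] at this
    · rw [h3_L hL]
      have := usage_light_scaled x T e (r + d + 2 * t - 2 * w) (1 + t - w) j (m + l) (p + h) hx0 hx1 he hPj hΔ3 hδ3 hB3pos hb3c hL.le
      rwa [div_sub_one hG3pos.ne'] at this
  obtain ⟨hU3pos, he3U⟩ := hu3
  have he3pos : 0 < e3 := by by_contra hn; have : e3 * usage x T j (m + l) (p + h) ≤ 0 := mul_nonpos_iff.2 (Or.inr ⟨not_lt.1 hn, hU3pos.le⟩); linarith
  have he3inv : 1 / e3 = usage x T j (m + l) (p + h) := by rw [div_eq_iff he3pos.ne', mul_comm]; exact he3U.symm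
  have hav4 : T < ((m + l' : ℕ) : ℝ) + ((p + h : ℕ) : ℝ) := by have h1 : e * (r + d - 2 * w) < e * (1 - w) := mul_lt_mul_of_pos_left hb4c he; linarith [hΔ4, hδ4]
  obtain ⟨e4, he4⟩ : ∃ e4 : ℝ, e4 = (((1 - w) - ((1 - x) * (r + d - 2 * w) + x ^ (2:ℕ) * (1 - w))) / ((1 - x) * (r + d - 2 * w) + x ^ (2:ℕ) * (1 - w))) := ⟨_, rfl⟩
  have hG4pos : 0 < (1 - x) * (r + d - 2 * w) + x ^ (2:ℕ) * (1 - w) := add_pos_of_pos_of_nonneg (mul_pos (by linarith) hA4pos) (mul_nonneg (sq_nonneg x) (by linarith))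
  have hu4 : 0 < usage x T j (m + l') (p + h) ∧ e4 * usage x T j (m + l') (p + h) = 1 := by
    rw [he4]
    have := usage_light_scaled x T e (r + d - 2 * w) (1 - w) j (m + l') (p + h) hx0 hx1 he hPj hΔ4 hδ4 hA4pos hb4c hb4.le
    rwa [div_sub_one hG4pos.ne'] at this
  obtain ⟨hU4pos, he4U⟩ := hu4
  have he4pos : 0 < e4 := by by_contra hn; have : e4 * usage x T j (m + l') (p + h) ≤ 0 := mul_nonpos_iff.2 (Or.inr ⟨not_lt.1 hn, hU4pos.le⟩); linarith
  have he4inv : 1 / e4 = usage x T j (m + l') (p + h) := by rw [div_eq_iff he4pos.ne', mul_comm]; exact he4U.symm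
  set f₄ : ℝ := if (x ^ (2:ℕ) + (1 - x) * ρc) * (1 - x) * (1 - lam) ≤ (1 - (x ^ (2:ℕ) + (1 - x) * ρc)) * x * e4 then (x ^ (2:ℕ) + (1 - x) * ρc) * (1 - x) * (1 - lam) else (1 - (x ^ (2:ℕ) + (1 - x) * ρc)) * x * e4 with hf₄
  have hf40 : 0 ≤ f₄ := by rw [hf₄]; split_ifs <;> positivity
  have hf4le : f₄ ≤ (x ^ (2:ℕ) + (1 - x) * ρc) * (1 - x) * (1 - lam) := by
    rw [hf₄]; split_ifs with hh
    · exact le_rfl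
    · exact (not_le.1 hh).le
  have hf4cap : usage x T j (m + l') (p + h) * f₄ ≤ (1 - (x ^ (2:ℕ) + (1 - x) * ρc)) * x := by
    rw [hf₄]; split_ifs with hh
    · calc usage x T j (m + l') (p + h) * ((x ^ (2:ℕ) + (1 - x) * ρc) * (1 - x) * (1 - lam)) ≤ usage x T j (m + l') (p + h) * ((1 - (x ^ (2:ℕ) + (1 - x) * ρc)) * x * e4) := mul_le_mul_of_nonneg_left hh hU4pos.le
        _ = (1 - (x ^ (2:ℕ) + (1 - x) * ρc)) * x * (e4 * usage x T j (m + l') (p + h)) := by ring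
        _ = (1 - (x ^ (2:ℕ) + (1 - x) * ρc)) * x := by rw [he4U, mul_one]
    · calc usage x T j (m + l') (p + h) * ((1 - (x ^ (2:ℕ) + (1 - x) * ρc)) * x * e4) = (1 - (x ^ (2:ℕ) + (1 - x) * ρc)) * x * (e4 * usage x T j (m + l') (p + h)) := by ring
        _ = (1 - (x ^ (2:ℕ) + (1 - x) * ρc)) * x := by rw [he4U, mul_one]
      exact le_rfl
  set cP1 : ℝ := (1 - (x ^ (2:ℕ) + (1 - x) * ρc)) * x - usage x T j (m + l') (p + h) * f₄ with hcP1
  have hcP10 : 0 ≤ cP1 := by rw [hcP1]; linarith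
  set pool1 : ℝ := (x ^ (2:ℕ) + (1 - x) * ρc) * (1 - x) - ((x ^ (2:ℕ) + (1 - x) * ρc) * (1 - x) * (1 - lam) - f₄) with hpool1
  set f₃ : ℝ := if (x ^ (2:ℕ) + (1 - x) * ρc) * (1 - x) * lam ≤ cP1 * e3 then (x ^ (2:ℕ) + (1 - x) * ρc) * (1 - x) * lam else cP1 * e3 with hf₃
  have hf30 : 0 ≤ f₃ := by rw [hf₃]; split_ifs <;> positivity
  have hf3le : f₃ ≤ (x ^ (2:ℕ) + (1 - x) * ρc) * (1 - x) * lam := by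
    rw [hf₃]; split_ifs with hh
    · exact le_rfl
    · exact (not_le.1 hh).le
  have hf3cap : usage x T j (m + l) (p + h) * f₃ ≤ cP1 := by
    rw [hf₃]; split_ifs with hh
    · calc usage x T j (m + l) (p + h) * ((x ^ (2:ℕ) + (1 - x) * ρc) * (1 - x) * lam) ≤ usage x T j (m + l) (p + h) * (cP1 * e3) := mul_le_mul_of_nonneg_left hh hU3pos.le
        _ = cP1 * (e3 * usage x T j (m + l) (p + h)) := by ring
        _ = cP1 := by rw [he3U, mul_one]
    · calc usage x T j (m + l) (p + h) * (cP1 * e3) = cP1 * (e3 * usage x T j (m + l) (p + h)) := by ring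
        _ = cP1 := by rw [he3U, mul_one]
      exact le_rfl
  set cPres : ℝ := cP1 - usage x T j (m + l) (p + h) * f₃ with hcPres
  set poolG : ℝ := (x ^ (2:ℕ) + (1 - x) * ρc) * x - x / (1 - x) * ((x ^ (2:ℕ) + (1 - x) * ρc) * (1 - x) * (1 - lam) - f₄) - x / (1 - x) * ((x ^ (2:ℕ) + (1 - x) * ρc) * (1 - x) * lam - f₃) with hpoolG
  have hcPres0 : 0 ≤ cPres := by rw [hcPres]; linarith
  have hx1' : (1 : ℝ) - x ≠ 0 := by linarith
  have hx0' : x ≠ 0 := hx0.ne'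
  have hpoolGu : poolG / (x / (1 - x)) = pool1 - ((x ^ (2:ℕ) + (1 - x) * ρc) * (1 - x) * lam - f₃) := by rw [div_eq_iff hu.ne', hpoolG, hpool1]; field_simp
  -- the four case hypotheses of the breakpoint lemmas, in closed form
  have hc4_f : ((x ^ (2:ℕ) + (1 - x) * d / w) * (1 - x) * ((1 + x - r) * (r - x + t * (2 - x)) / (t * (2 - x ^ (2:ℕ) - (1 - x) * r) - x * (x - r)))) ≤ ((1 - (x ^ (2:ℕ) + (1 - x) * d / w)) * x) * (((1 - w) - ((1 - x) * (r + d - 2 * w) + x ^ (2:ℕ) * (1 - w))) / ((1 - x) * (r + d - 2 * w) + x ^ (2:ℕ) * (1 - w))) → cP1 = ((1 - (x ^ (2:ℕ) + (1 - x) * d / w)) * x) - ((x ^ (2:ℕ) + (1 - x) * d / w) * (1 - x) * ((1 + x - r) * (r - x + t * (2 - x)) / (t * (2 - x ^ (2:ℕ) - (1 - x) * r) - x * (x - r)))) / (((1 - w) - ((1 - x) * (r + d - 2 * w) + x ^ (2:ℕ) * (1 - w))) / ((1 - x) * (r + d - 2 * w) + x ^ (2:ℕ) * (1 - w))) ∧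 pool1 = ((x ^ (2:ℕ) + (1 - x) * d / w) * (1 - x)) := by
    rw [hgd, hlaml_eq, ← he4]
    intro hle
    have hf : f₄ = (x ^ (2:ℕ) + (1 - x) * ρc) * (1 - x) * (1 - lam) := by rw [hf₄, if_pos hle]
    refine ⟨?_, ?_⟩
    · rw [hcP1, hf, div_eq_mul_one_div, he4inv]; ring
    · rw [hpool1, hf]; ring
  have hc4_s : ((1 - (x ^ (2:ℕ) + (1 - x) * d / w)) * x) * (((1 - w) - ((1 - x) * (r + d - 2 * w) + x ^ (2:ℕ) * (1 - w))) / ((1 - x) * (r + d - 2 * w) + x ^ (2:ℕ) * (1 - w))) < ((x ^ (2:ℕ) + (1 - x) * d / w) * (1 - x) * ((1 + x - r) * (r - x + t * (2 - x)) / (t * (2 - x ^ (2:ℕ) - (1 - x) * r) - x * (x - r)))) → cP1 = 0 ∧ pool1 = (((x ^ (2:ℕ) + (1 - x) * d / w) * (1 - x)) - ((x ^ (2:ℕ) + (1 - x) * d / w) * (1 - x) * ((1 + x - r) * (r - x + t * (2 - x)) / (t * (2 - x ^ (2:ℕ) - (1 - x) * r) - x * (x - r)))) + ((1 - (x ^ (2:ℕ)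 + (1 - x) * d / w)) * x) * (((1 - w) - ((1 - x) * (r + d - 2 * w) + x ^ (2:ℕ) * (1 - w))) / ((1 - x) * (r + d - 2 * w) + x ^ (2:ℕ) * (1 - w)))) := by
    rw [hgd, hlaml_eq, ← he4]
    intro hlt
    have hf : f₄ = (1 - (x ^ (2:ℕ) + (1 - x) * ρc)) * x * e4 := by rw [hf₄, if_neg (not_le.2 hlt)]
    refine ⟨?_, ?_⟩
    · rw [hcP1, hf]
      calc (1 - (x ^ (2:ℕ) + (1 - x) * ρc)) * x - usage x T j (m + l') (p + h) * ((1 - (x ^ (2:ℕ) + (1 - x) * ρc)) * x * e4) = (1 - (x ^ (2:ℕ) + (1 - x) * ρc)) * x * (1 - e4 * usage x T j (m + l') (p + h)) := by ring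
        _ = 0 := by rw [he4U]; ring
    · rw [hpool1, hf]; ring
  have hc3_f : ((x ^ (2:ℕ) + (1 - x) * d / w) * (1 - x) * ((x - r) * (1 - t - r) / (t * (2 - x ^ (2:ℕ) - (1 - x) * r) - x * (x - r)))) ≤ cP1 * e3 → cPres = cP1 - ((x ^ (2:ℕ) + (1 - x) * d / w) * (1 - x) * ((x - r) * (1 - t - r) / (t * (2 - x ^ (2:ℕ) - (1 - x) * r) - x * (x - r)))) / e3 ∧ poolG / (x / (1 - x)) = pool1 := by
    rw [hgd, hlam_eq]
    intro hle
    have hf : f₃ = (x ^ (2:ℕ) + (1 - x) * ρc) * (1 - x) * lam := by rw [hf₃, if_pos hle]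
    refine ⟨?_, ?_⟩
    · rw [hcPres, hf, div_eq_mul_one_div, he3inv]; ring
    · rw [hpoolGu, hf]; ring
  have hc3_s : cP1 * e3 < ((x ^ (2:ℕ) + (1 - x) * d / w) * (1 - x) * ((x - r) * (1 - t - r) / (t * (2 - x ^ (2:ℕ) - (1 - x) * r) - x * (x - r)))) → cPres = 0 ∧ poolG / (x / (1 - x)) = (pool1 - ((x ^ (2:ℕ) + (1 - x) * d / w) * (1 - x) * ((x - r) * (1 - t - r) / (t * (2 - x ^ (2:ℕ) - (1 - x) * r) - x * (x - r)))) + cP1 * e3) := by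
    rw [hgd, hlam_eq]
    intro hlt
    have hf : f₃ = cP1 * e3 := by rw [hf₃, if_neg (not_le.2 hlt)]
    refine ⟨?_, ?_⟩
    · rw [hcPres, hf]
      calc cP1 - usage x T j (m + l) (p + h) * (cP1 * e3) = cP1 * (1 - e3 * usage x T j (m + l) (p + h)) := by ring
        _ = 0 := by rw [he3U]; ring
    · rw [hpoolGu, hf]; ring
  have hkG' := kG_LLG x r t d w e2P e3 cP1 pool1 cPres (poolG / (x / (1 - x))) hx0 hx1 hρl0 hρlx ht0 hw0 hw1 hd0 hdx hre hre1 hM2'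
    h2P_N h2P_H h2P_L h3_H h3_L hc4_f hc4_s hc3_f hc3_s
  have hkB' := kB_LLG x r t d w e2P e3 κC cP1 pool1 cPres (poolG / (x / (1 - x))) hx0 hx1 hρl0 hρlx ht0 hw0 hw1 hd0 hdx hre hre1 hM2'
    h2P_N h2P_H h2P_L h3_H h3_L hκC_N hκC_H hκC_L hc4_f hc4_s hc3_f hc3_s
  have hG0' := G0_LLG x r t d w e3 cP1 pool1 cPres (poolG / (x / (1 - x))) hx0 hx1 hρl0 hρlx ht0 hw0 hw1 hd0 hdx hre hre1 hM2'
    h3_H h3_L hc4_f hc4_s hc3_f hc3_s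
  have hc4_s' := hc4_s
  rw [hgd, hlaml_eq, ← he4] at hc4_s'
  have hc3_s' := hc3_s
  rw [hgd, hlam_eq] at hc3_s'
  rw [hgd, hlam_eq, hlaml_eq] at hkG'
  rw [hgd, hlam_eq, hlaml_eq, ← he4] at hkB'
  have hpoolG0 : 0 ≤ poolG := by have := mul_nonneg hG0' hu.le; rwa [div_mul_cancel₀ _ hu.ne'] at this
  -- if a pre-routing saturates the head cell then `cPres = 0`
  have hcPres_zero_of : ¬ ((x ^ (2:ℕ) + (1 - x) * ρc) * (1 - x) * (1 - lam) ≤ (1 - (x ^ (2:ℕ) + (1 - x) * ρc)) * x * e4 ∧ (x ^ (2:ℕ) + (1 - x) * ρc) * (1 - x) * lam ≤ cP1 * e3) → cPres = 0 := by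
    intro hn
    by_cases h4 : (x ^ (2:ℕ) + (1 - x) * ρc) * (1 - x) * (1 - lam) ≤ (1 - (x ^ (2:ℕ) + (1 - x) * ρc)) * x * e4
    · have h3 : ¬ (x ^ (2:ℕ) + (1 - x) * ρc) * (1 - x) * lam ≤ cP1 * e3 := fun hh => hn ⟨h4, hh⟩
      exact (hc3_s' (not_le.1 h3)).1
    · obtain ⟨hc10, _⟩ := hc4_s' (not_le.1 h4)
      have h3 : ¬ (x ^ (2:ℕ) + (1 - x) * ρc) * (1 - x) * lam ≤ cP1 * e3 := by
        rw [hc10, zero_mul, not_le]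
        exact mul_pos (mul_pos hγ0 (by linarith)) (by
          rw [← hlam_eq]; exact div_pos (mul_pos (by linarith) (by linarith)) hD)
      exact (hc3_s' (not_le.1 h3)).1
  obtain ⟨F₁A, F₁B, F₁C, R₁, F₂A, F₂B, F₂C, R₂, f1A0, f1B0, f1C0, R10, f2A0, f2B0, f2C0, R20,
      av1A, av1B, av1C, av2A, av2B, av2C, row1, row2, capA, capB, capC, capG⟩ :=
    twoLow_greedy_flows ((1 - (x ^ (2:ℕ) + (1 - x) * ρc)) * (1 - x) * lam) ((1 - (x ^ (2:ℕ) + (1 - x) * ρc)) * (1 - x) * (1 - lam)) (x / (1 - x)) poolG 0 cPres 0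
      1 1 (usage x T j (p + l) (p + h)) (usage x T j (p + l') (p + h)) 1 1
      0 (cPres * e1P) (cPres * e2P) 0 0 0 κC 0
      False False (T < ((p + l : ℕ) : ℝ) + ((p + h : ℕ) : ℝ)) (T < ((p + l' : ℕ) : ℝ) + ((p + h : ℕ) : ℝ)) False False
      hc1 hc2 hu hpoolG0 le_rfl hcPres0 le_rfl
      le_rfl (mul_nonneg hcPres0 he1P0) (mul_nonneg hcPres0 he2P0) le_rfl le_rfl
      (fun hF => hF.elim) (fun _ => rfl)
      (fun hav => by obtain ⟨h1, h2⟩ := huC1 (havC1.1 hav); exact ⟨h1, by rw [mul_assoc, h2, mul_one]⟩)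
      (fun hn => by rw [h1P_N (not_lt.1 (fun hh => hn (havC1.2 hh))), mul_zero])
      (fun hav => by obtain ⟨h1, h2⟩ := huC2 (havC2.1 hav); exact ⟨h1, by rw [mul_assoc, h2, mul_one]⟩)
      (fun hn => by rw [h2P_N (not_lt.1 (fun hh => hn (havC2.2 hh))), mul_zero])
      (fun hF => hF.elim) (fun _ => rfl) (fun hF => hF.elim) (fun _ => rfl)
      le_rfl (fun hF => hF.elim) (fun _ => rfl)
      hκC0
      (fun hav => by
        have h1 := havC1.1 hav
        have h2 : r + d < 1 := by linarith
        obtain ⟨_, u1⟩ := huC1 h1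
        obtain ⟨_, u2⟩ := huC2 h2
        have h3 := hκCe h1
        calc κC * usage x T j (p + l) (p + h)
            = κC * usage x T j (p + l) (p + h) * (e2P * usage x T j (p + l') (p + h)) := by rw [u2, mul_one]
          _ = (κC * e2P) * usage x T j (p + l) (p + h) * usage x T j (p + l') (p + h) := by ring
          _ = (e1P * usage x T j (p + l) (p + h)) * usage x T j (p + l') (p + h) := by rw [h3]
          _ = usage x T j (p + l') (p + h) := by rw [u1, one_mul])
      (fun hn => hκC_N (not_lt.1 (fun hh => hn (havC1.2 hh))))
      le_rfl (fun hF => hF.elim) (fun _ => rfl)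
      (fun hF _ => hF.elim)
      (fun hav hlo hhi => by
        by_cases hfit : (x ^ (2:ℕ) + (1 - x) * ρc) * (1 - x) * (1 - lam) ≤ (1 - (x ^ (2:ℕ) + (1 - x) * ρc)) * x * e4 ∧ (x ^ (2:ℕ) + (1 - x) * ρc) * (1 - x) * lam ≤ cP1 * e3
        · have hB := hkB' (havC2.1 hav) hfit.1 hfit.2 (by simpa only [zero_add] using hhi)
          simp only [zero_add, add_zero]
          exact hB
        · have hc0 := hcPres_zero_of hfit
          simp only [hc0, zero_mul, add_zero] at hhi
          have hP2z : (1 - (x ^ (2:ℕ) + (1 - x) * ρc)) * (1 - x) * (1 - lam) = 0 := le_antisymm hhi hc2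
          have hG := hkG' (by rw [hc0, zero_mul]; exact hc2)
          rw [hc0, zero_mul, zero_add, hP2z, add_zero] at hG
          simp only [hc0, zero_mul, zero_add, add_zero, hP2z, sub_self]
          linarith)
      (fun hF _ _ => hF.elim)
      (fun hsum => by simp only [zero_add, add_zero]; exact hkG' (by simpa only [zero_add, add_zero] using hsum))
  have hsum : (1 - (x ^ (2:ℕ) + (1 - x) * ρc)) * (1 - x) * lam + (1 - (x ^ (2:ℕ) + (1 - x) * ρc)) * (1 - x) * (1 - lam) + (1 - (x ^ (2:ℕ) + (1 - x) * ρc)) * x + (x ^ (2:ℕ) + (1 - x) * ρc) * (1 - x) * lam + (x ^ (2:ℕ) + (1 - x) * ρc) * (1 - x) * (1 - lam) + (x ^ (2:ℕ) + (1 - x) * ρc) * x = 1 := by ring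
  have hlow : 2 * ((p : ℝ) + l') < T := by have := mul_pos he hApos; linarith [hTA]
  have hF1A0 : F₁A = 0 := by by_contra hne; exact av1A (lt_of_le_of_ne f1A0 (Ne.symm hne))
  have hF2A0 : F₂A = 0 := by by_contra hne; exact av2A (lt_of_le_of_ne f2A0 (Ne.symm hne))
  have hF1C0 : F₁C = 0 := by by_contra hne; exact av1C (lt_of_le_of_ne f1C0 (Ne.symm hne))
  have hF2C0 : F₂C = 0 := by by_contra hne; exact av2C (lt_of_le_of_ne f2C0 (Ne.symm hne))
  have hR1 : F₁B ≤ (1 - (x ^ (2:ℕ) + (1 - x) * ρc)) * (1 - x) * lam := by linarith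
  have hR2 : F₂B ≤ (1 - (x ^ (2:ℕ) + (1 - x) * ρc)) * (1 - x) * (1 - lam) := by linarith
  have hcapP' : usage x T j (p + l) (p + h) * F₁B + usage x T j (p + l') (p + h) * F₂B + usage x T j (m + l) (p + h) * f₃ + usage x T j (m + l') (p + h) * f₄ ≤ (1 - (x ^ (2:ℕ) + (1 - x) * ρc)) * x := by
    have : usage x T j (p + l) (p + h) * F₁B + usage x T j (p + l') (p + h) * F₂B ≤ cPres := capB
    rw [hcPres, hcP1] at this; linarith
  have hcapG' : x / (1 - x) * (((1 - (x ^ (2:ℕ) + (1 - x) * ρc)) * (1 - x) * lam - F₁B) + ((1 - (x ^ (2:ℕ) + (1 - x) * ρc)) * (1 - x) * (1 - lam) - F₂B) + ((x ^ (2:ℕ) + (1 - x) * ρc) * (1 - x) * lam - f₃) + ((x ^ (2:ℕ) + (1 - x) * ρc) * (1 - x) * (1 - lam) - f₄)) ≤ (x ^ (2:ℕ) + (1 - x) * ρc) * x := by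
    have e1 : ((1 - (x ^ (2:ℕ) + (1 - x) * ρc)) * (1 - x) * lam - F₁B) + ((1 - (x ^ (2:ℕ) + (1 - x) * ρc)) * (1 - x) * (1 - lam) - F₂B) = R₁ + R₂ := by
      rw [hF1A0, hF1C0] at row1; rw [hF2A0, hF2C0] at row2; linarith
    have : x / (1 - x) * (R₁ + R₂) ≤ poolG := capG
    rw [hpoolG] at this
    have e2 : x / (1 - x) * (((1 - (x ^ (2:ℕ) + (1 - x) * ρc)) * (1 - x) * lam - F₁B) + ((1 - (x ^ (2:ℕ) + (1 - x) * ρc)) * (1 - x) * (1 - lam) - F₂B) + ((x ^ (2:ℕ) + (1 - x) * ρc) * (1 - x) * lam - f₃) + ((x ^ (2:ℕ) + (1 - x) * ρc) * (1 - x) * (1 - lam) - f₄))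
        = x / (1 - x) * (R₁ + R₂) + x / (1 - x) * ((x ^ (2:ℕ) + (1 - x) * ρc) * (1 - x) * lam - f₃) + x / (1 - x) * ((x ^ (2:ℕ) + (1 - x) * ρc) * (1 - x) * (1 - lam) - f₄) := by rw [← e1]; ring
    rw [e2]; linarith
  exact lsLaw_decAtT_of_flow_LLG x T ((1 - (x ^ (2:ℕ) + (1 - x) * ρc)) * (1 - x) * lam) ((1 - (x ^ (2:ℕ) + (1 - x) * ρc)) * (1 - x) * (1 - lam)) ((1 - (x ^ (2:ℕ) + (1 - x) * ρc)) * x) ((x ^ (2:ℕ) + (1 - x) * ρc) * (1 - x) * lam) ((x ^ (2:ℕ) + (1 - x) * ρc) * (1 - x) * (1 - lam)) ((x ^ (2:ℕ) + (1 - x) * ρc) * x) F₁B F₂B f₃ f₄ p m l l' h j M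
    hx0 hx1 hsum hpm hll hlh hlow hM2 hA2 hPj hGj hGM f1B0 f2B0 hf30 hf40
    av1B av2B (fun _ => hav3) (fun _ => hav4) hR1 hR2 hf3le hf4le hcapP' hcapG'
end LawDec
end Quant
end Summit.CriticalPhenomena.PercolationContinuityZ3.Theorems
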